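import Summits.RiemannHypothesis.RiemannHypothesis.Theorems.WeilColumnThetaUC
import Summits.RiemannHypothesis.RiemannHypothesis.Theorems.WeilColumnThetaPrimeBoundsCheb
import HarnessLib

/-!
# THETA kernel certificate: (AN) WITHOUT Rosser–Schoenfeld — `ψ ≤ C·x` only beyond `N = e^{−2x₁}`; the Chebyshev corollary (RH-FREE)

Cell `rh-explicit`, WEIL column, seat weil-1 gen20 (director-rh g5 2026-08-26T09:40Z ruling (1)(b): the RS-free twin of (AN)).
`WeilColumnThetaUC.uc_of_loss_lt_gain` assumes `ψ(x) ≤ 1.03883·x` on `[0, ∞)`; but the partial summation of THETA-CERT-cc6 §D6 only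
evaluates `ψ` on `[N_k, ∞)`, `N_k = e^{−2(x₁ + 1/(k+1))}` (handoff-prove-2 ATTEMPT-22 §5, `WeilColumnThetaPrimeTailCheb`). Hence:
§1 `norm_weilPrimeTerm_oddTail_le_of_ge` (prime side under `ψ ≤ C·x` on `[e^{−2x₁}, ∞)` only); §2 `re_weilQuadratic_moll_oddTail_le_of_ge`
(PR Step 5′, free `A′, B′`, level `k`, `ψ ≤ C·x` on `[N_k, ∞)` only); §3 `ψ ≤ C·x` on `[N, ∞)` + monotonicity ⇒ `ψ ≤ C·e^{2/(k+1)}·x` on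
`[N_k, ∞)` (so the NON-strict side condition `e² ≤ N` suffices) and the limit of the level-`k` constant; §4 **`uc_of_loss_lt_gain_of_psi_le`**
(ANY `C ≥ 0` with `ψ ≤ C·x` on `[e^{−2x₁}, ∞)`: `primesC + 2·C·M²(1/m² + e^{−m/(m+1)}/(m+1)) + arch t₀ + atom < gain J ⇒ a*(S_q) < (log q⁺)/2`)
and the HYPOTHESIS-FREE **`ucCheb_of_lossCheb_lt_gain`** (`C(N) = log 4 + 2·log N/√N`, `N ≥ e²`, Mathlib `Chebyshev.psi_le` via
`ThetaPrime.psi_le_cheb_linear`), whose certificate hypothesis is `P.lossCheb t₀ < P.gain J` of cc-s2-1's `ThetaTier1ChebBridge` by `rfl`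
and whose side condition is their `chebN_ge`; the landed RS theorem `uc_of_loss_lt_gain` is the case `C = rsConst`.
Upper-clause bookkeeping only; nothing here bears on the truth of RH.
-/

noncomputable section

set_option linter.dupNamespace false

open Complex Set MeasureTheory Filter
open scoped Real Topology ArithmeticFunction.vonMangoldt Chebyshev

namespace Summit.RiemannHypothesis.RiemannHypothesis.Theorems.WeilColumn.ThetaMellin

open Literature.NumberTheory.LFunctions Literature.NumberTheory.LFunctions.WeilContinuous ThetaParams

namespace ThetaParams

/-! ## §1 The prime side under `ψ ≤ C·x` beyond `N = e^{−2x₁}` only -/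

/-- **`primes` with the hypothesis only beyond `N`**: as `norm_weilPrimeTerm_oddTail_le`, but assuming `ψ(x) ≤ C·x` only for
`x ≥ e^{−2x₁}` (the partial summation never evaluates `ψ` below `N`). [THETA-CERT-cc6 §D6; ATTEMPT-22 §5] -/
theorem norm_weilPrimeTerm_oddTail_le_of_ge {T g : ℝ → ℂ} {E x₁ C a : ℝ} {m : ℕ} (hm : 2 ≤ m) (hx₁ : x₁ < 0) (hE : 0 ≤ E)
    (hT0 : ∀ u, x₁ < u → T u = 0)
    (hTE : ∀ u, u ≤ x₁ → ‖T u‖ ≤ E * Real.exp (((m : ℝ) + 1 / 2) * (u - x₁)))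
    (hgt : IsWeilTest g) (hsupp : tsupport g ⊆ Icc (-a) a) (hg : ∀ u, g u = T u - T (-u))
    (hC : 0 ≤ C) (hψ : ∀ x : ℝ, Real.exp (-2 * x₁) ≤ x → ψ x ≤ C * x) :
    ‖weilPrimeTerm (weilConv g (weilReflect g))‖ ≤
      2 * E ^ 2 / ((m : ℝ) + 1 / 2) * vonMangoldtSum (m + 1) +
        2 * E ^ 2 * Real.sqrt (Real.exp (-2 * x₁)) *
          (C * (Real.exp (-((m : ℝ) / ((m : ℝ) + 1))) / ((m : ℝ) + 1) + 1 / (m : ℝ) ^ 2)) := by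
  have hN : 0 < Real.exp (-2 * x₁) := Real.exp_pos _
  have hS₂ := fun K ↦ ThetaPrime.vonMangoldt_logTail_sum_le_of_ge (m := m) (by omega) hN hC hψ K
  have h := ThetaPrime.norm_weilPrimeTerm_le_of_oddTail (by omega) hx₁ hE hT0 hTE hgt hsupp hg
    (fun K ↦ sum_vonMangoldt_div_pow_le hm K) hS₂
  refine h.trans (le_of_eq ?_)
  have hNm : Real.exp (-2 * x₁) ^ m ≠ 0 := pow_ne_zero _ hN.ne'
  have e : Real.exp (-2 * x₁) ^ m * Real.sqrt (Real.exp (-2 * x₁)) *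
      (C * (Real.exp (-((m : ℝ) / ((m : ℝ) + 1))) / ((m : ℝ) + 1) + 1 / (m : ℝ) ^ 2) / Real.exp (-2 * x₁) ^ m) =
      Real.sqrt (Real.exp (-2 * x₁)) * (C * (Real.exp (-((m : ℝ) / ((m : ℝ) + 1))) / ((m : ℝ) + 1) + 1 / (m : ℝ) ^ 2)) := by
    rw [mul_div_assoc', mul_comm (Real.exp (-2 * x₁) ^ m) (Real.sqrt _), mul_assoc, mul_div_assoc,
      mul_div_cancel_left₀ _ hNm]
  rw [mul_assoc (2 * E ^ 2) (Real.exp (-2 * x₁) ^ m * Real.sqrt (Real.exp (-2 * x₁))), e, ← mul_assoc]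

/-! ## §2 PR Step 5′ at level `k` under `ψ ≤ C·x` beyond `N_k = e^{−2(x₁ + 1/(k+1))}` only -/

variable {T : ℝ → ℂ}

/-- **PR Step 5′ at level `k`, free `A′, B′`, `ψ ≤ C·x` only beyond `N_k = e^{−2(x₁+1/(k+1))}`** (proof of handoff-prove-2's
`re_weilQuadratic_moll_oddTail_le'` verbatim with §1 for D6). [THETA-CERT-cc6 §D5–D7; THETA-ASSIGN §6 Step 5; ATTEMPT-22 §5] -/
theorem re_weilQuadratic_moll_oddTail_le_of_ge (P : ThetaParams) {f : ℝ → ℂ} {E x₁ C a t₀ A' B' : ℝ} {qn : ℕ}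
    (hP : P.Admissible qn) (hTc : Continuous T) (hT0 : ∀ u, x₁ < u → T u = 0) (hE : 0 ≤ E)
    (hTE : ∀ u, ‖T u‖ ≤ E * Real.exp (((P.m : ℝ) + 1 / 2) * (u - x₁)))
    (hf : ∀ u, f u = T u - T (-u)) (hf1 : ContDiff ℝ 1 f) (hfs : HasCompactSupport f) (hsupp : tsupport f ⊆ Icc (-a) a)
    (hA : ∫ x, ‖f x‖ ^ 2 ≤ A') (hB : ∫ x, ‖deriv f x‖ ^ 2 ≤ B') (ht₀ : 0 < t₀) (ht₁ : t₀ ≤ 1)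
    (k : ℕ) (hk : x₁ + 1 / ((k : ℝ) + 1) < 0)
    (hC : 0 ≤ C) (hψ : ∀ x : ℝ, Real.exp (-2 * (x₁ + 1 / ((k : ℝ) + 1))) ≤ x → ψ x ≤ C * x) :
    (weilQuadratic (weilConv f (moll k))).re ≤
      2 * (E * Real.exp ((2 * P.m + 1) / ((k : ℝ) + 1))) ^ 2 / ((P.m : ℝ) + 1 / 2) * vonMangoldtSum (P.m + 1) +
        2 * (E * Real.exp ((2 * P.m + 1) / ((k : ℝ) + 1))) ^ 2 * Real.sqrt (Real.exp (-2 * (x₁ + 1 / ((k : ℝ) + 1)))) *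
          (C * (Real.exp (-((P.m : ℝ) / ((P.m : ℝ) + 1))) / ((P.m : ℝ) + 1) + 1 / (P.m : ℝ) ^ 2)) +
        (B' / 2 * Real.exp (t₀ / 2) * t₀ ^ 2 / 2 +
          A' * max 0 (2 * Jexplicit t₀ - Real.log (4 * π) - Real.eulerMascheroniConstant - archC₁)) := by
  have hm2 : 2 ≤ P.m := le_trans (by norm_num) hP.three_le
  set r : ℝ := 1 / ((k : ℝ) + 1) with hr
  set g : ℝ → ℂ := weilConv f (moll k) with hgdef
  set Tk : ℝ → ℂ := weilConv T (moll k) with hTk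
  have hr0 : 0 < r := by positivity
  have hκ : 0 ≤ (P.m : ℝ) + 1 / 2 := by positivity
  have hfc : Continuous f := hf1.continuous
  have hfeq : f = fun u ↦ T u - T (-u) := funext hf
  have hg : ∀ u, g u = Tk u - Tk (-u) := fun u ↦ by
    simp only [hgdef, hTk]; rw [hfeq]; exact weilConv_oddPart_moll hTc k u
  have hTk0 : ∀ u, x₁ + r < u → Tk u = 0 := fun u hu ↦ weilConv_moll_tail_eq_zero hT0 k hu
  have hTkE : ∀ u, u ≤ x₁ + r → ‖Tk u‖ ≤ E * Real.exp ((2 * P.m + 1) / ((k : ℝ) + 1)) *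
      Real.exp (((P.m : ℝ) + 1 / 2) * (u - (x₁ + r))) := by
    intro u _
    refine (norm_weilConv_moll_tail_le hE hκ hTE k u).trans (le_of_eq ?_)
    rw [mul_assoc, ← Real.exp_add]
    congr 2
    rw [hr]; field_simp; ring
  have hgt : IsWeilTest g := isWeilTest_weilConv_moll hfc hfs k
  have hfz : ∀ u, a < |u| → f u = 0 := by
    intro u hu
    by_contra hne
    have hmem := hsupp (subset_tsupport _ (Function.mem_support.2 hne))
    have : |u| ≤ a := abs_le.2 ⟨by linarith [hmem.1], hmem.2⟩
    linarith
  have hsuppg : tsupport g ⊆ Icc (-(a + 1)) (a + 1) := by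
    refine closure_minimal (fun x hx ↦ ?_) isClosed_Icc
    rw [Function.mem_support] at hx
    by_contra h
    refine hx (weilConv_moll_eq_zero hfz ?_ k)
    rw [mem_Icc, not_and_or, not_le, not_le] at h
    rcases h with h | h
    · exact lt_of_lt_of_le (by linarith) (neg_le_abs x)
    · exact lt_of_lt_of_le h (le_abs_self x)
  have hodd : ∀ t, g (-t) = -g t := fun t ↦ by rw [hg, hg, neg_neg]; ring
  have hD5 : (weilPolarTerm (weilConv g (weilReflect g))).re ≤ 0 := by
    rw [re_weilPolarTerm_weilConv_weilReflect_of_odd hgt hodd]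
    nlinarith [norm_nonneg (weilMellin g 0)]
  have hE' : 0 ≤ E * Real.exp ((2 * P.m + 1) / ((k : ℝ) + 1)) := by positivity
  have hD6 := norm_weilPrimeTerm_oddTail_le_of_ge (a := a + 1) hm2 hk hE' hTk0 hTkE hgt hsuppg hg hC hψ
  have hA' : ∫ x, ‖g x‖ ^ 2 ≤ A' := (integral_norm_sq_weilConv_moll_le hfc hfs k).trans hA
  have hB' : ∫ x, ‖deriv g x‖ ^ 2 ≤ B' := (integral_norm_sq_deriv_weilConv_moll_le hf1 hfs k).trans hB
  have hD7' := ThetaArch.re_weilArchTerm_weilConv_weilReflect_le_thetaCheck hgt hA' hB' ht₀ ht₁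
  have key : ∀ J L γ C : ℝ, 2 * J - (L + γ) - C = 2 * J - L - γ - C := fun _ _ _ _ ↦ by ring
  rw [key] at hD7'
  have hD7 : (weilArchTerm (weilConv g (weilReflect g))).re ≤ B' / 2 * Real.exp (t₀ / 2) * t₀ ^ 2 / 2 +
      A' * max 0 (2 * Jexplicit t₀ - Real.log (4 * π) - Real.eulerMascheroniConstant - archC₁) := by
    refine hD7'.trans (le_of_eq ?_)
    unfold Jexplicit archC₁
    ring
  have hre : (weilQuadratic g).re = (weilPolarTerm (weilConv g (weilReflect g))).re -
      (weilPrimeTerm (weilConv g (weilReflect g))).re + (weilArchTerm (weilConv g (weilReflect g))).re := by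
    simp [weilQuadratic, weilFunctional]
  have hP6 : -(weilPrimeTerm (weilConv g (weilReflect g))).re ≤ ‖weilPrimeTerm (weilConv g (weilReflect g))‖ := by
    have := Complex.abs_re_le_norm (weilPrimeTerm (weilConv g (weilReflect g)))
    exact (neg_le_abs _).trans this
  rw [hre]
  linarith

/-! ## §3 The level-`k` constant: inflating `C` by `e^{2/(k+1)}` and its limit -/

/-- If `ψ(x) ≤ C·x` for `x ≥ N` (`N > 0`, `C ≥ 0`) then `ψ(x) ≤ C·eˢ·x` for `x ≥ N·e^{−s}` (`s ≥ 0`; `ψ` monotone: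
on `[N e^{−s}, N]`, `ψ(x) ≤ ψ(N) ≤ C·N ≤ C·eˢ·x`). [folklore] -/
theorem psi_le_inflate {N C s : ℝ} (hN : 0 < N) (hC : 0 ≤ C) (hs : 0 ≤ s)
    (hψ : ∀ x : ℝ, N ≤ x → ψ x ≤ C * x) {x : ℝ} (hx : N * Real.exp (-s) ≤ x) :
    ψ x ≤ C * Real.exp s * x := by
  have hes : 1 ≤ Real.exp s := Real.one_le_exp hs
  have hx0 : 0 < x := lt_of_lt_of_le (by positivity) hx
  by_cases hxN : N ≤ x
  · calc ψ x ≤ C * x := hψ x hxN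
      _ = C * 1 * x := by ring
      _ ≤ C * Real.exp s * x := by gcongr
  · have hxN' : x ≤ N := (not_le.1 hxN).le
    have hNx : N ≤ Real.exp s * x := by
      have h := mul_le_mul_of_nonneg_left hx (Real.exp_pos s).le
      rwa [← mul_assoc, mul_comm (Real.exp s) N, mul_assoc, ← Real.exp_add, add_neg_cancel, Real.exp_zero,
        mul_one] at h
    calc ψ x ≤ ψ N := Chebyshev.psi_mono hxN'
      _ ≤ C * N := hψ N le_rfl
      _ ≤ C * (Real.exp s * x) := mul_le_mul_of_nonneg_left hNx hC
      _ = C * Real.exp s * x := by ring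

/-- From `ψ ≤ C·x` on `[e^{−2x₁}, ∞)` to `ψ ≤ C·e^{2/(k+1)}·x` on `[e^{−2(x₁+1/(k+1))}, ∞)`. [folklore] -/
theorem psi_le_levelK {x₁ C : ℝ} (hC : 0 ≤ C) (hψ : ∀ x : ℝ, Real.exp (-2 * x₁) ≤ x → ψ x ≤ C * x) (k : ℕ)
    {x : ℝ} (hx : Real.exp (-2 * (x₁ + 1 / ((k : ℝ) + 1))) ≤ x) :
    ψ x ≤ C * Real.exp (2 / ((k : ℝ) + 1)) * x := by
  have hs : (0 : ℝ) ≤ 2 / ((k : ℝ) + 1) := by positivity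
  refine psi_le_inflate (Real.exp_pos _) hC hs hψ ?_
  rw [← Real.exp_add]
  convert hx using 2
  ring

/-- The level-`k` constant with the inflated `C·e^{2/(k+1)}` tends, as `k → ∞`, to
`2E²/(m+½)·S + 2E²·√(e^{−2x₁})·(C·K₀)`. [folklore] -/
theorem tendsto_levelKC (P : ThetaParams) (E x₁ C K₀ S : ℝ) :
    Tendsto (fun k : ℕ ↦
      2 * (E * Real.exp ((2 * P.m + 1) / ((k : ℝ) + 1))) ^ 2 / ((P.m : ℝ) + 1 / 2) * S +
        2 * (E * Real.exp ((2 * P.m + 1) / ((k : ℝ) + 1))) ^ 2 * Real.sqrt (Real.exp (-2 * (x₁ + 1 / ((k : ℝ) + 1)))) *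
          (C * Real.exp (2 / ((k : ℝ) + 1)) * K₀))
      atTop (𝓝 (2 * E ^ 2 / ((P.m : ℝ) + 1 / 2) * S + 2 * E ^ 2 * Real.sqrt (Real.exp (-2 * x₁)) * (C * K₀))) := by
  have h0 : Tendsto (fun k : ℕ ↦ 1 / ((k : ℝ) + 1)) atTop (𝓝 0) := tendsto_one_div_add_atTop_nhds_zero_nat
  have hexp1 : ∀ c : ℝ, Tendsto (fun k : ℕ ↦ Real.exp (c / ((k : ℝ) + 1))) atTop (𝓝 1) := by
    intro c
    have hc : Tendsto (fun k : ℕ ↦ c * (1 / ((k : ℝ) + 1))) atTop (𝓝 0) := by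
      simpa using h0.const_mul c
    have h := (Real.continuous_exp.tendsto 0).comp hc
    rw [Real.exp_zero] at h
    refine h.congr fun k ↦ ?_
    simp only [Function.comp_apply]
    congr 1
    ring
  have h2 : Tendsto (fun k : ℕ ↦ (E * Real.exp ((2 * P.m + 1) / ((k : ℝ) + 1))) ^ 2) atTop (𝓝 (E ^ 2)) := by
    simpa using ((hexp1 (2 * P.m + 1)).const_mul E).pow 2
  have h3 : Tendsto (fun k : ℕ ↦ Real.sqrt (Real.exp (-2 * (x₁ + 1 / ((k : ℝ) + 1))))) atTop
      (𝓝 (Real.sqrt (Real.exp (-2 * x₁)))) := by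
    have ha : Tendsto (fun k : ℕ ↦ -2 * (x₁ + 1 / ((k : ℝ) + 1))) atTop (𝓝 (-2 * x₁)) := by
      simpa using (h0.const_add x₁).const_mul (-2)
    exact (Real.continuous_sqrt.tendsto _).comp ((Real.continuous_exp.tendsto _).comp ha)
  have h4 : Tendsto (fun k : ℕ ↦ C * Real.exp (2 / ((k : ℝ) + 1)) * K₀) atTop (𝓝 (C * K₀)) := by
    simpa using ((hexp1 2).const_mul C).mul_const K₀
  have hA : Tendsto (fun k : ℕ ↦ 2 * (E * Real.exp ((2 * P.m + 1) / ((k : ℝ) + 1))) ^ 2 / ((P.m : ℝ) + 1 / 2) * S)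
      atTop (𝓝 (2 * E ^ 2 / ((P.m : ℝ) + 1 / 2) * S)) :=
    ((h2.const_mul 2).div_const ((P.m : ℝ) + 1 / 2)).mul_const S
  have hB : Tendsto (fun k : ℕ ↦ 2 * (E * Real.exp ((2 * P.m + 1) / ((k : ℝ) + 1))) ^ 2 *
      Real.sqrt (Real.exp (-2 * (x₁ + 1 / ((k : ℝ) + 1)))) * (C * Real.exp (2 / ((k : ℝ) + 1)) * K₀)) atTop
      (𝓝 (2 * E ^ 2 * Real.sqrt (Real.exp (-2 * x₁)) * (C * K₀))) :=
    ((h2.const_mul 2).mul h3).mul h4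
  exact hA.add hB

/-- At `E = M√u₁`, `x₁ = P.x₁`: `2E²/(m+½)·ΣΛ(n)n^{−(m+1)} + 2E²·√(e^{−2x₁})·C·(e^{−m/(m+1)}/(m+1) + 1/m²) = primesC + 2·C·M²·(…)`
(at `C = rsConst` the second summand is `P.cross`). [THETA-CERT-cc6 §D6] -/
theorem levelKC_limit_eq (P : ThetaParams) (C : ℝ) :
    2 * (P.M * Real.sqrt P.u₁) ^ 2 / ((P.m : ℝ) + 1 / 2) * vonMangoldtSum (P.m + 1) +
        2 * (P.M * Real.sqrt P.u₁) ^ 2 * Real.sqrt (Real.exp (-2 * P.x₁)) *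
          (C * (Real.exp (-((P.m : ℝ) / ((P.m : ℝ) + 1))) / ((P.m : ℝ) + 1) + 1 / (P.m : ℝ) ^ 2)) =
      P.primesC + 2 * C * P.M ^ 2 * (1 / (P.m : ℝ) ^ 2 + Real.exp (-(P.m : ℝ) / (P.m + 1)) / (P.m + 1)) := by
  have hu : 0 < P.u₁ := Real.exp_pos _
  have hsq : (P.M * Real.sqrt P.u₁) ^ 2 = P.M ^ 2 * P.u₁ := by
    rw [mul_pow, Real.sq_sqrt hu.le]
  have hroot : Real.sqrt (Real.exp (-2 * P.x₁)) = P.u₁⁻¹ := by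
    have e : Real.exp (-2 * P.x₁) = Real.exp (-P.x₁) ^ 2 := by
      rw [← Real.exp_nat_mul]; ring_nf
    rw [e, Real.sqrt_sq (Real.exp_pos _).le, Real.exp_neg]
    rfl
  have hexp : Real.exp (-((P.m : ℝ) / ((P.m : ℝ) + 1))) = Real.exp (-(P.m : ℝ) / (P.m + 1)) := by
    congr 1; ring
  have hm : (P.m : ℝ) + 1 / 2 ≠ 0 := by positivity
  have hm2 : (2 : ℝ) * P.m + 1 ≠ 0 := by positivity
  rw [hsq, hroot, hexp]
  unfold primesC
  field_simp
  ring

/-- The level-`k` constant at the witness (constant `C·e^{2/(k+1)}`) tends to `primesC + 2·C·M²·(1/m² + e^{−m/(m+1)}/(m+1))`. [THETA-CERT-cc6 §D6] -/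
theorem tendsto_levelKC_witness (P : ThetaParams) (C : ℝ) :
    Tendsto (fun k : ℕ ↦
      2 * (P.M * Real.sqrt P.u₁ * Real.exp ((2 * P.m + 1) / ((k : ℝ) + 1))) ^ 2 / ((P.m : ℝ) + 1 / 2) *
          vonMangoldtSum (P.m + 1) +
        2 * (P.M * Real.sqrt P.u₁ * Real.exp ((2 * P.m + 1) / ((k : ℝ) + 1))) ^ 2 *
          Real.sqrt (Real.exp (-2 * (P.x₁ + 1 / ((k : ℝ) + 1)))) *
          (C * Real.exp (2 / ((k : ℝ) + 1)) *
            (Real.exp (-((P.m : ℝ) / ((P.m : ℝ) + 1))) / ((P.m : ℝ) + 1) + 1 / (P.m : ℝ) ^ 2)))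
      atTop (𝓝 (P.primesC + 2 * C * P.M ^ 2 * (1 / (P.m : ℝ) ^ 2 + Real.exp (-(P.m : ℝ) / (P.m + 1)) / (P.m + 1)))) := by
  have h := tendsto_levelKC P (P.M * Real.sqrt P.u₁) P.x₁ C
    (Real.exp (-((P.m : ℝ) / ((P.m : ℝ) + 1))) / ((P.m : ℝ) + 1) + 1 / (P.m : ℝ) ^ 2) (vonMangoldtSum (P.m + 1))
  have e : 2 * (P.M * Real.sqrt P.u₁) ^ 2 * Real.sqrt (Real.exp (-2 * P.x₁)) *
      (C * (Real.exp (-((P.m : ℝ) / ((P.m : ℝ) + 1))) / ((P.m : ℝ) + 1) + 1 / (P.m : ℝ) ^ 2)) =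
      2 * (P.M * Real.sqrt P.u₁) ^ 2 * Real.sqrt (Real.exp (-2 * P.x₁)) *
        C * (Real.exp (-((P.m : ℝ) / ((P.m : ℝ) + 1))) / ((P.m : ℝ) + 1) + 1 / (P.m : ℝ) ^ 2) := by ring
  rw [← mul_assoc (2 * (P.M * Real.sqrt P.u₁) ^ 2 * Real.sqrt (Real.exp (-2 * P.x₁))), ← e, levelKC_limit_eq P C] at h
  exact h

/-! ## §4 (AN) under `ψ ≤ C·x` beyond `N` only, and the Chebyshev corollary -/

variable {P : ThetaParams}

/-- **STEP 5′ FOR THE TRUNCATED TAIL under `ψ ≤ C·x` on `[e^{−2x₁}, ∞)` only** (`C ≥ 0`; `R ≥ 0`, `0 < t₀ ≤ 1`, `x₁ + 1/(k+1) < 0`):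
`Re Q(TR_k) ≤ levelK_C(k) + archR(R)`, the level-`k` constant carrying `C·e^{2/(k+1)}` (§3). [THETA-ASSIGN v1.1 §6 Step 5; ATTEMPT-22 §5] -/
theorem re_weilQuadratic_TRk_le_of_ge {qn : ℕ} (hP : P.Admissible qn) {C : ℝ} (hC : 0 ≤ C)
    (hψ : ∀ x : ℝ, Real.exp (-2 * P.x₁) ≤ x → ψ x ≤ C * x)
    {t₀ : ℝ} (ht₀ : 0 < t₀) (ht₁ : t₀ ≤ 1) {R : ℝ} (hR : 0 ≤ R) (k : ℕ) (hk : P.x₁ + 1 / ((k : ℝ) + 1) < 0) :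
    (weilQuadratic (weilConv (P.TROdd R) (moll k))).re ≤
      2 * (P.M * Real.sqrt P.u₁ * Real.exp ((2 * P.m + 1) / ((k : ℝ) + 1))) ^ 2 / ((P.m : ℝ) + 1 / 2) *
            vonMangoldtSum (P.m + 1) +
          2 * (P.M * Real.sqrt P.u₁ * Real.exp ((2 * P.m + 1) / ((k : ℝ) + 1))) ^ 2 *
            Real.sqrt (Real.exp (-2 * (P.x₁ + 1 / ((k : ℝ) + 1)))) *
            (C * Real.exp (2 / ((k : ℝ) + 1)) *
              (Real.exp (-((P.m : ℝ) / ((P.m : ℝ) + 1))) / ((P.m : ℝ) + 1) + 1 / (P.m : ℝ) ^ 2)) +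
        (((∫ x, ‖deriv (P.TROdd R) x‖ ^ 2) + (P.B - ∫ x, ‖deriv P.TOdd x‖ ^ 2)) / 2 * Real.exp (t₀ / 2) * t₀ ^ 2 / 2 +
          P.A * max 0 (2 * Jexplicit t₀ - Real.log (4 * π) - Real.eulerMascheroniConstant - archC₁)) := by
  have hΘ' : ∀ u : ℝ, 0 < u → HasDerivAt P.Θ (deriv P.Θ u) u := fun u hu ↦ P.hasDerivAt_deriv_Θ hP hu
  have hM₁ := P.D2_on_Ioc hP
  have hM0 : 0 ≤ P.M * Real.sqrt P.u₁ := by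
    have h := le_trans (norm_nonneg _) (P.norm_Θ_le' hP Real.zero_lt_one)
    have hc : 0 < (1 / P.u₁) ^ P.m := by have : 0 < P.u₁ := Real.exp_pos _; positivity
    have : 0 ≤ P.M := le_of_mul_le_mul_right (by rwa [zero_mul]) hc
    positivity
  have hBtot : ∫ x, ‖deriv (P.TROdd R) x‖ ^ 2 ≤ (∫ x, ‖deriv (P.TROdd R) x‖ ^ 2) + (P.B - ∫ x, ‖deriv P.TOdd x‖ ^ 2) := by
    have := P.integral_norm_sq_deriv_TOdd_le hP hΘ' hM₁
    linarith
  have hCk : 0 ≤ C * Real.exp (2 / ((k : ℝ) + 1)) := by positivity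
  exact P.re_weilQuadratic_moll_oddTail_le_of_ge hP (T := P.TR R) (continuous_TR hP R) (fun u hu ↦ TR_eq_zero_of_gt hP R hu)
    hM0 (fun u ↦ norm_TR_le hP R u) (fun u ↦ rfl) (contDiff_one_TROdd hP R) (hasCompactSupport_TROdd hP R)
    (tsupport_TROdd_subset hP hR) (P.integral_norm_sq_TROdd_le hP R) hBtot ht₀ ht₁ k hk hCk
    (fun x hx ↦ psi_le_levelK hC hψ k hx)

/-- **(AN) under `ψ ≤ C·x` beyond `N` only, MODULO STEP 2** (`C ≥ 0`, `ψ ≤ C·x` on `[e^{−2x₁}, ∞)`, `0 < t₀ ≤ 1`, `0 < J`,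
`primesC + 2·C·M²(1/m² + e^{−m/(m+1)}/(m+1)) + arch t₀ + atom < gain J`, Step-2 decay `W_G(R) → 0` as a hypothesis ⇒
`a*(S_q) < (log q⁺)/2`). [THETA-ASSIGN v1.0 §2 (AN); ATTEMPT-22 §5; RH-FREE] -/
theorem uc_of_loss_lt_gain_of_psi_le_of_GRdecay {qn : ℕ} (hP : P.Admissible qn) (hcons : Handoff.ConsecutivePrimes P.q qn)
    {C : ℝ} (hC : 0 ≤ C) (hψ : ∀ x : ℝ, Real.exp (-2 * P.x₁) ≤ x → ψ x ≤ C * x)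
    {t₀ : ℝ} (ht₀ : 0 < t₀) (ht₁ : t₀ ≤ 1) {J : ℕ} (hJ : 0 < J)
    (hlg : P.primesC + 2 * C * P.M ^ 2 * (1 / (P.m : ℝ) ^ 2 + Real.exp (-(P.m : ℝ) / (P.m + 1)) / (P.m + 1)) +
      P.arch t₀ + P.atom < P.gain J)
    {WG : ℝ → ℝ} {R₁ : ℝ} (hWG0 : ∀ R, R₁ ≤ R → 0 ≤ WG R) (hWGlim : Tendsto WG atTop (𝓝 0))
    (hG : ∀ R : ℝ, R₁ ≤ R → ∀ k : ℕ, ∀ ρ : ℂ, ρ ∈ RHWave0.riemannZetaNontrivialZeros →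
      ‖weilMellin (weilConv (P.GROdd R) (moll k)) ρ‖ ≤ WG R / ‖ρ - 1 / 2‖) :
    MotivicDoor.SemilocalThreshold.weilSemilocalThreshold (Nat.primesBelow P.q) < Real.log qn / 2 := by
  have hq1 : 1 ≤ P.q := le_trans (by norm_num) hcons.1.two_le
  have hm2 : 2 ≤ P.m := le_trans (by norm_num) hP.three_le
  have hΘ' : ∀ u : ℝ, 0 < u → HasDerivAt P.Θ (deriv P.Θ u) u := fun u hu ↦ P.hasDerivAt_deriv_Θ hP hu
  obtain ⟨β, hβ, hbr⟩ := exists_bracket_tendsto_zero hP hΘ' (P.continuousOn_deriv_Θ hP) (P.D2_on_Ioc hP) hWG0 hWGlim hG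
  set R₀ : ℝ := max (max P.a R₁) 0 with hR₀
  have hsteps : ∀ᶠ k : ℕ in atTop, ∀ R : ℝ, R₀ ≤ R →
      (weilQuadratic (P.phi k)).re ≤
        (2 * (P.M * Real.sqrt P.u₁ * Real.exp ((2 * P.m + 1) / ((k : ℝ) + 1))) ^ 2 / ((P.m : ℝ) + 1 / 2) *
              vonMangoldtSum (P.m + 1) +
            2 * (P.M * Real.sqrt P.u₁ * Real.exp ((2 * P.m + 1) / ((k : ℝ) + 1))) ^ 2 *
              Real.sqrt (Real.exp (-2 * (P.x₁ + 1 / ((k : ℝ) + 1)))) *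
              (C * Real.exp (2 / ((k : ℝ) + 1)) *
                (Real.exp (-((P.m : ℝ) / ((P.m : ℝ) + 1))) / ((P.m : ℝ) + 1) + 1 / (P.m : ℝ) ^ 2))) +
          (((∫ x, ‖deriv (P.TROdd R) x‖ ^ 2) + (P.B - ∫ x, ‖deriv P.TOdd x‖ ^ 2)) / 2 * Real.exp (t₀ / 2) * t₀ ^ 2 / 2 +
            P.A * max 0 (2 * Jexplicit t₀ - Real.log (4 * π) - Real.eulerMascheroniConstant - archC₁)) +
          β R := by
    filter_upwards [eventually_x₁_add_lt_zero hP] with k hk R hR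
    have hR' : max P.a R₁ ≤ R := le_trans (le_max_left _ _) hR
    have hR0 : 0 ≤ R := le_trans (le_max_right _ _) hR
    have h1 := hbr k R hR'
    have h2 := re_weilQuadratic_TRk_le_of_ge hP hC hψ ht₀ ht₁ hR0 k hk
    linarith
  have hB : ∀ e : ℝ, 0 < e → ∀ᶠ k : ℕ in atTop,
      (weilQuadratic (P.phi k)).re ≤
        (P.primesC + 2 * C * P.M ^ 2 * (1 / (P.m : ℝ) ^ 2 + Real.exp (-(P.m : ℝ) / (P.m + 1)) / (P.m + 1))) +
          P.arch t₀ + e := fun e he ↦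
    eventually_re_weilQuadratic_phi_le_of_steps hsteps (tendsto_levelKC_witness P C) (tendsto_archR hP t₀) hβ he
  have hgain := P.gain_le hP.delta_pos hm2 hJ hq1
  have hlt : (P.primesC + 2 * C * P.M ^ 2 * (1 / (P.m : ℝ) ^ 2 + Real.exp (-(P.m : ℝ) / (P.m + 1)) / (P.m + 1)) +
      P.arch t₀) - 2 * Real.log P.q * P.Itop + P.atom < 0 := by
    linarith
  exact weilSemilocalThreshold_lt_of_full_le hP hcons hB hlt

/-- **(AN) UNDER `ψ ≤ C·x` BEYOND `N = e^{−2x₁}` ONLY.** For an admissible row `P` with consecutive primes `q < q⁺`, any `C ≥ 0` with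
`ψ(x) ≤ C·x` for `x ≥ e^{−2x₁}`, `0 < t₀ ≤ 1`, `0 < J` and `primesC + 2·C·M²(1/m² + e^{−m/(m+1)}/(m+1)) + arch t₀ + atom < gain J`:
**`a*(S_q) < (log q⁺)/2`** (Step 2 = cc-s2-3's `norm_weilMellin_GROdd_moll_le`). [THETA-ASSIGN v1.0 §2 (AN); ATTEMPT-22 §5; RH-FREE] -/
theorem uc_of_loss_lt_gain_of_psi_le {qn : ℕ} (hP : P.Admissible qn) (hcons : Handoff.ConsecutivePrimes P.q qn)
    {C : ℝ} (hC : 0 ≤ C) (hψ : ∀ x : ℝ, Real.exp (-2 * P.x₁) ≤ x → ψ x ≤ C * x)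
    {t₀ : ℝ} (ht₀ : 0 < t₀) (ht₁ : t₀ ≤ 1) {J : ℕ} (hJ : 0 < J)
    (hlg : P.primesC + 2 * C * P.M ^ 2 * (1 / (P.m : ℝ) ^ 2 + Real.exp (-(P.m : ℝ) / (P.m + 1)) / (P.m + 1)) +
      P.arch t₀ + P.atom < P.gain J) :
    MotivicDoor.SemilocalThreshold.weilSemilocalThreshold (Nat.primesBelow P.q) < Real.log qn / 2 := by
  obtain ⟨Lψ, hL0, hL⟩ := exists_abs_deriv_smoothTransition_le
  have hΘ' : ∀ u : ℝ, 0 < u → HasDerivAt P.Θ (deriv P.Θ u) u := fun u hu ↦ P.hasDerivAt_deriv_Θ hP hu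
  have hu : 0 < P.u₁ := Real.exp_pos _
  have hM : 0 ≤ P.M := by
    have h := le_trans (norm_nonneg _) (P.norm_Θ_le' hP Real.zero_lt_one)
    have hc : 0 < (1 / P.u₁) ^ P.m := by positivity
    exact le_of_mul_le_mul_right (by rwa [zero_mul]) hc
  have hM₁ : 0 ≤ P.M₁ := by
    have h := le_trans (norm_nonneg _) (P.D2_on_Ioc hP P.u₁ ⟨hu, le_rfl⟩)
    rwa [div_self hu.ne', one_pow, mul_one] at h
  have hm1 : (0 : ℝ) < ((P.m : ℝ) - 1 / 2) - 1 / 2 := by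
    have : (3 : ℝ) ≤ P.m := by exact_mod_cast hP.three_le
    linarith
  have hCG : 0 ≤ ((3 / 2 + Lψ) * P.M) / P.u₁ ^ P.m + P.M₁ / P.u₁ ^ (P.m - 1) := by positivity
  have hexp : Tendsto (fun R : ℝ ↦ Real.exp ((((P.m : ℝ) - 1 / 2) - 1 / 2) * (-R))) atTop (𝓝 0) := by
    have h1 : Tendsto (fun R : ℝ ↦ (((P.m : ℝ) - 1 / 2) - 1 / 2) * (-R)) atTop atBot :=
      tendsto_neg_atTop_atBot.const_mul_atBot hm1
    exact Real.tendsto_exp_atBot.comp h1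
  have hWGlim : Tendsto (fun R : ℝ ↦ Real.exp (1 / 2) * (2 *
      ((((3 / 2 + Lψ) * P.M) / P.u₁ ^ P.m + P.M₁ / P.u₁ ^ (P.m - 1)) * Real.exp ((((P.m : ℝ) - 1 / 2) - 1 / 2) * (-R)) /
        (((P.m : ℝ) - 1 / 2) - 1 / 2)))) atTop (𝓝 0) := by
    simpa using (((hexp.const_mul _).div_const (((P.m : ℝ) - 1 / 2) - 1 / 2)).const_mul 2).const_mul (Real.exp (1 / 2))
  refine uc_of_loss_lt_gain_of_psi_le_of_GRdecay hP hcons hC hψ ht₀ ht₁ hJ hlg (R₁ := P.a)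
    (WG := fun R : ℝ ↦ Real.exp (1 / 2) * (2 *
      ((((3 / 2 + Lψ) * P.M) / P.u₁ ^ P.m + P.M₁ / P.u₁ ^ (P.m - 1)) * Real.exp ((((P.m : ℝ) - 1 / 2) - 1 / 2) * (-R)) /
        (((P.m : ℝ) - 1 / 2) - 1 / 2))))
    (fun R _ ↦ by positivity) hWGlim fun R hR k ρ hρ ↦ ?_
  exact P.norm_weilMellin_GROdd_moll_le hP hΘ' (P.continuousOn_deriv_Θ hP) (P.D2_on_Ioc hP) hL0 hL hR k hρ

/-- **(AN), HYPOTHESIS-FREE — THE CHEBYSHEV FORM.** For an admissible row `P` with consecutive primes `q < q⁺`, `e² ≤ N = e^{−2x₁}`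
(the checker's side condition, cc-s2-1's `chebN_ge`), `0 < t₀ ≤ 1`, `0 < J` and, with `C(N) = log 4 + 2·log N/√N`,
`primesC + 2·C(N)·M²(1/m² + e^{−m/(m+1)}/(m+1)) + arch t₀ + atom < gain J` (= `P.lossCheb t₀ < P.gain J` of `ThetaTier1ChebBridge` by
`rfl`): **`a*(S_q) < (log q⁺)/2`** — `ψ ≤ C(N)·x` on `[N, ∞)` is Mathlib's Chebyshev bound (`ThetaPrime.psi_le_cheb_linear`); NO
Rosser–Schoenfeld input. [Chebyshev; THETA-ASSIGN v1.0 §2 (AN); ATTEMPT-22 §5; RH-FREE] -/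
theorem ucCheb_of_lossCheb_lt_gain {qn : ℕ} (hP : P.Admissible qn) (hcons : Handoff.ConsecutivePrimes P.q qn)
    (hN : Real.exp 2 ≤ Real.exp (-2 * P.x₁)) {t₀ : ℝ} (ht₀ : 0 < t₀) (ht₁ : t₀ ≤ 1) {J : ℕ} (hJ : 0 < J)
    (hlg : P.primesC +
        2 * (Real.log 4 + 2 * (Real.log (Real.exp (-2 * P.x₁)) / Real.sqrt (Real.exp (-2 * P.x₁)))) * P.M ^ 2 *
          (1 / (P.m : ℝ) ^ 2 + Real.exp (-(P.m : ℝ) / (P.m + 1)) / (P.m + 1)) +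
      P.arch t₀ + P.atom < P.gain J) :
    MotivicDoor.SemilocalThreshold.weilSemilocalThreshold (Nat.primesBelow P.q) < Real.log qn / 2 :=
  uc_of_loss_lt_gain_of_psi_le hP hcons (ThetaPrime.cheb_const_nonneg hN)
    (fun _ hx ↦ ThetaPrime.psi_le_cheb_linear hN hx) ht₀ ht₁ hJ hlg

end ThetaParams

end Summit.RiemannHypothesis.RiemannHypothesis.Theorems.WeilColumn.ThetaMellin

end
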